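import Summits.ABC.IUTFork.Joshi.FrobenioidsJoshiGlobal

/-!
# Joshi, ATS III (arXiv 2401.13508v4) (10.5.2)–(10.5.4): the global arithmetic degree of a number field is a
# HOMOMORPHISM on `L^*` — DERIVABLE row of `Joshi/FrobenioidsJoshiGlobal.lean`, discharged

Proof-only companion (abc-iut cell, branch E, seat abc-iut-E-t34, slot T-34a; rung LADDER-ABC:A2.E). TAKES NO SIDE
on [IUTchIII] Cor. 3.12 or on any author; typed ≠ proved; everything below is kernel-checked Mathlib arithmetic of
absolute values. [claim: Joshi2024ATS3, status: disputed]

WHAT. Joshi (p.133 l.26–p.134 l.1): `Frob(L)` "comes equipped with the homomorphism `L^* → Φ(L)^gp = ⊕_v Φ(L_v)^gp`"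
(10.5.2) "and also a global arithmetic degree homomorphism `Φ(L) → ℝ`" (10.5.3) "`(x_v) ↦ Σ_v log(|x_v|_{L_v})`"
(10.5.4) "… which factors through `Φ(L)^gp` as `ℝ` is a group". `Joshi/FrobenioidsJoshiGlobal.lean` typed the
composite `L^* → ℝ` as the bare function `globalDeg` and proved the product formula (10.5.5); here: `globalDeg` is
multiplicative-to-additive on `L^*` (`globalDeg_mul`), kills `1` and inverts inverses — i.e. it IS a homomorphism
`L^* → ℝ`, as print says. (With (10.5.5) it is of course the zero homomorphism — `globalDeg_eq_zero` — which is the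
content of the product formula; the additivity is recorded separately because it holds place by place.)
-/

noncomputable section

namespace Summit.ABC.IUTFork.Joshi.ATS3

open NumberField

variable (L : Type) [Field L] [NumberField L]

variable {L} in
omit [NumberField L] in
/-- The local archimedean degrees are additive: `log|xy|_v = log|x|_v + log|y|_v` (weighted by the local degree
`mult v`). [folklore] -/
theorem localDegInf_mul (w : InfinitePlace L) {x y : L} (hx : x ≠ 0) (hy : y ≠ 0) :
    localDegInf L w (x * y) = localDegInf L w x + localDegInf L w y := by
  simp only [localDegInf]
  rw [map_mul, Real.log_mul (w.pos_iff.mpr hx).ne' (w.pos_iff.mpr hy).ne', mul_add]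

variable {L} in
/-- The local non-archimedean degrees are additive. [folklore] -/
theorem localDegFin_mul (v : FinitePlace L) {x y : L} (hx : x ≠ 0) (hy : y ≠ 0) :
    localDegFin L v (x * y) = localDegFin L v x + localDegFin L v y := by
  simp only [localDegFin]
  rw [map_mul, Real.log_mul (FinitePlace.pos_iff.mpr hx).ne' (FinitePlace.pos_iff.mpr hy).ne']

variable {L} in
/-- Only finitely many finite places contribute to the degree of `x ≠ 0` (the sum (10.5.4) is finite). [folklore] -/
theorem support_localDegFin_finite {x : L} (hx : x ≠ 0) :
    (Function.support fun v : FinitePlace L => localDegFin L v x).Finite := by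
  have hfin : (Function.mulSupport fun v : FinitePlace L => v x).Finite := FinitePlace.hasFiniteMulSupport hx
  refine hfin.subset fun v hv => ?_
  simp only [Function.mem_support, Function.mem_mulSupport] at hv ⊢
  intro h1
  exact hv (by simp [localDegFin, h1])

variable {L} in
/-- **(10.5.2)–(10.5.4): the global arithmetic degree is a homomorphism `L^* → ℝ`** — additivity.
[claim: Joshi2024ATS3, status: disputed] -/
theorem globalDeg_mul {x y : L} (hx : x ≠ 0) (hy : y ≠ 0) :
    globalDeg L (x * y) = globalDeg L x + globalDeg L y := by
  simp only [globalDeg]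
  rw [Finset.sum_congr rfl fun w _ => localDegInf_mul w hx hy, Finset.sum_add_distrib,
    finsum_congr fun v => localDegFin_mul v hx hy,
    finsum_add_distrib (support_localDegFin_finite hx) (support_localDegFin_finite hy)]
  ring

/-- … it sends `1` to `0` … [folklore] -/
theorem globalDeg_one : globalDeg L 1 = 0 := globalDeg_eq_zero one_ne_zero

variable {L} in
/-- … and inverses to negatives. [folklore] -/
theorem globalDeg_inv {x : L} (hx : x ≠ 0) : globalDeg L x⁻¹ = -globalDeg L x := by
  have h := globalDeg_mul hx (inv_ne_zero hx)
  rw [mul_inv_cancel₀ hx, globalDeg_one] at h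
  linarith

variable {L} in
/-- … and integer powers to multiples. [folklore] -/
theorem globalDeg_pow {x : L} (hx : x ≠ 0) (n : ℕ) : globalDeg L (x ^ n) = n * globalDeg L x := by
  induction n with
  | zero => simp [globalDeg_one]
  | succ n ih => rw [pow_succ, globalDeg_mul (pow_ne_zero n hx) hx, ih]; push_cast; ring

end Summit.ABC.IUTFork.Joshi.ATS3

end
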